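import Summits.MatrixMultiplication.OmegaCensus.DominoNormUnitEquation
import Summits.MatrixMultiplication.OmegaCensus.RadonProjection3
import Summits.MatrixMultiplication.OmegaCensus.DominoLineCertificate
import Mathlib.Algebra.BigOperators.Ring.Finset
import HarnessLib

/-!
# Character identities of a three-set cube form: the mate formula and the norm relations `D_WX · D_WY = Γ_W`

ω-census `pub-omega`, family (b3), seat pub-omega-group gen 31.  Framing: lottery ticket; floor = certified bounds/negative
ranges.  VALUE: the exact algebraic skeleton behind any norm argument for the THREE-SET column of the Dih-side
`|A| ≡ 1 (mod 3)` classification (the three-set analogue of `DominoNormUnitEquation.lean`, which is the case `|W| = 1`,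
`w = w̄ = 1`); NOT progress on ω, and NOT a congruence: see "What is deliberately not here".

Setting.  A three-set cube form `(W, X, Y, x₀)` over `A` (`CubeSymmetricForm.cube_symmetric_form_of_law`) pushed to a
quotient `φ : A →+ B` gives count functions `W X Y : B → ℕ` with the three-set line identity of
`RadonProjection3.radon_identity₃`, `Σ_u Σ_v W(v)·(X(t−u+v) + X(v+u−t) + X(t+u−v))·Y(u) + [s = t] = K` for all `t`.
At a non-trivial character `χ` of `B`, with `w = χ(W)`, `w̄ = χ⁻¹(W)` etc. and `ρ = χ(s)`, `ρ̄ = χ⁻¹(s)`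
(**`char_identity₃`**):  `w̄xy + wx̄y + wxȳ = −ρ`.  Everything below follows from this equation and its conjugate by
polynomial algebra (section `Algebra`, stated for arbitrary complex numbers), then is specialised to character sums
(section `Characters`).  With `D(π, π̄) := π² + ππ̄ + π̄² = Dsh 1 π π̄` and `Γ_W := ρ̄²w² − ρρ̄·ww̄ + ρ²w̄² = Dsh (−1) (ρ̄w) (ρw̄)`:
* **mate formula** (`mate_mul_D`, `chs_mate`): `y · D(xw̄, x̄w) = ρ̄wx − ρ(xw̄ + x̄w)` — the third set is determined by the
  other two and `x₀` ("uniqueness of mates", cf. Kreher–Martin–Stinson arXiv:2411.15890 for near-factorisations);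
* **antisymmetric identity** (`antisym_identity`): `w̄²xy − w²x̄ȳ = ρ̄w − ρw̄`;
* **pair products** (`D_mul_D`, `chs_D_mul_D`): `D(xw̄,x̄w) · D(yw̄,ȳw) = Γ_W` — for `|W| = 1` (`w = w̄ = 1`) the right side is
  the unit `ρ̄² − 1 + ρ²` of `DominoNorm.Dval_mul_Dval`; for `|W| ≥ 2` it is NOT a unit in general;
* **triple product** (`triple_D`, `chs_triple_D`): `D_WX · D_WY · D_XY = 1 + ρ̄³·wxy + ρ³·w̄x̄ȳ`
  (`= 1 + V + V̄`, `V = χ(W+X+Y)`, when `s = 0`);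
* **twisted products** (`prod_twist`): `(w + t w̄)(x + t x̄)(y + t ȳ) = wxy − tρ − t²ρ̄ + t³ w̄x̄ȳ` for every scalar `t`
  (`t = 1`: `(w+w̄)(x+x̄)(y+ȳ) = V + V̄ − ρ − ρ̄`; `t = −1`: `(w−w̄)(x−x̄)(y−ȳ) = V − V̄ + ρ − ρ̄`; `t = ω` a primitive cube
  root of unity and `s = 0`: `(w+ωw̄)(x+ωx̄)(y+ωȳ) = 1 + V + V̄`).
What is deliberately NOT here.  No unit is produced for `|W| ≥ 2`: on the single-character variety `{u = −ρ, ū = −ρ̄}` none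
of `Γ_W`, `D_WX`, `1 + V + V̄` is a unit (RESULTS-g30 §4), and the seat's enumeration of LOCAL solutions (multisets on `ℤ_p`,
`p ∈ {7, 11}`) exhibits solutions of the line identity where `1 + V + V̄` has norm `43², 131², …` (seat notes
`HOME/pub-omega-group-g31/RESULTS-g31.md` §3), so no line-by-line unit law exists either; hence no Wieferich-type
congruence for three-set cells is claimed here.
-/

namespace Summit.MatrixMultiplication.OmegaCensus.ThreeSetNorm

open Finset DominoNorm

/-! ## Polynomial identities on the variety `w̄xy + wx̄y + wxȳ = −ρ`, `wx̄ȳ + w̄xȳ + w̄x̄y = −ρ̄` -/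

section Algebra

variable {w w' x x' y y' ρ ρ' : ℂ}

/-- **Mate formula** (numerator form): `y · D(xw̄, x̄w) = ρ̄·wx − ρ·(xw̄ + x̄w)`, obtained by eliminating `ȳ` from the
equation and its conjugate (`τ·y + m·ȳ = −ρ`, `m̄·y + τ·ȳ = −ρ̄` with `τ = xw̄ + x̄w`, `m = wx`). [folklore] -/
theorem mate_mul_D (hu : w' * x * y + w * x' * y + w * x * y' = -ρ)
    (hu' : w * x' * y' + w' * x * y' + w' * x' * y = -ρ') :
    y * Dsh 1 (x * w') (x' * w) = ρ' * (w * x) - ρ * (x * w' + x' * w) := by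
  unfold Dsh
  linear_combination (x * w' + x' * w) * hu - (w * x) * hu'

/-- **Antisymmetric identity**: `w̄²·xy − w²·x̄ȳ = ρ̄·w − ρ·w̄`. [folklore] -/
theorem antisym_identity (hu : w' * x * y + w * x' * y + w * x * y' = -ρ)
    (hu' : w * x' * y' + w' * x * y' + w' * x' * y = -ρ') :
    w' ^ 2 * x * y - w ^ 2 * x' * y' = ρ' * w - ρ * w' := by
  linear_combination w' * hu - w * hu'

/-- Product of the two mate numerators through `W`: `ν_Y · ν_X = xy · Γ_W` with
`Γ_W = ρ̄²w² − ρρ̄ ww̄ + ρ²w̄² = Dsh (−1) (ρ̄w) (ρw̄)`. [folklore] -/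
theorem nu_mul_nu (hu : w' * x * y + w * x' * y + w * x * y' = -ρ)
    (hu' : w * x' * y' + w' * x * y' + w' * x' * y = -ρ') :
    (ρ' * (w * x) - ρ * (x * w' + x' * w)) * (ρ' * (w * y) - ρ * (y * w' + y' * w)) =
      x * y * Dsh (-1) (ρ' * w) (ρ * w') := by
  unfold Dsh
  linear_combination (-(ρ * ρ' * w)) * hu + (ρ ^ 2 * w) * hu'

/-- **Pair products**: `D(xw̄, x̄w) · D(yw̄, ȳw) = Γ_W = ρ̄²w² − ρρ̄ ww̄ + ρ²w̄²`.  For `w = w̄ = 1`, `ρρ̄ = 1` this is the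
domino unit equation `D(x)D(y) = ρ̄² − 1 + ρ²` (`DominoNorm.Dval_mul_Dval`). [folklore] -/
theorem D_mul_D (hu : w' * x * y + w * x' * y + w * x * y' = -ρ)
    (hu' : w * x' * y' + w' * x * y' + w' * x' * y = -ρ') (hx : x ≠ 0) (hy : y ≠ 0) :
    Dsh 1 (x * w') (x' * w) * Dsh 1 (y * w') (y' * w) = Dsh (-1) (ρ' * w) (ρ * w') := by
  have h1 := mate_mul_D hu hu'
  have hv : w' * y * x + w * y' * x + w * y * x' = -ρ := by linear_combination hu
  have hv' : w * y' * x' + w' * y * x' + w' * y' * x = -ρ' := by linear_combination hu'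
  have h2 := mate_mul_D hv hv'
  have h3 := nu_mul_nu hu hu'
  have key : x * y * (Dsh 1 (x * w') (x' * w) * Dsh 1 (y * w') (y' * w)) =
      x * y * Dsh (-1) (ρ' * w) (ρ * w') := by
    calc x * y * (Dsh 1 (x * w') (x' * w) * Dsh 1 (y * w') (y' * w))
        = (y * Dsh 1 (x * w') (x' * w)) * (x * Dsh 1 (y * w') (y' * w)) := by ring
      _ = (ρ' * (w * x) - ρ * (x * w' + x' * w)) * (ρ' * (w * y) - ρ * (y * w' + y' * w)) := by rw [h1, h2]
      _ = x * y * Dsh (-1) (ρ' * w) (ρ * w') := h3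
  exact mul_left_cancel₀ (mul_ne_zero hx hy) key

/-- **Twisted products**: `(w + t w̄)(x + t x̄)(y + t ȳ) = wxy − tρ − t²ρ̄ + t³ w̄x̄ȳ` for every scalar `t`. [folklore] -/
theorem prod_twist (hu : w' * x * y + w * x' * y + w * x * y' = -ρ)
    (hu' : w * x' * y' + w' * x * y' + w' * x' * y = -ρ') (t : ℂ) :
    (w + t * w') * (x + t * x') * (y + t * y') = w * x * y - t * ρ - t ^ 2 * ρ' + t ^ 3 * (w' * x' * y') := by
  linear_combination t * hu + t ^ 2 * hu'

/-- **Triple product**: `D_WX · D_WY · D_XY = 1 + ρ̄³·wxy + ρ³·w̄x̄ȳ` (uses `ρρ̄ = 1`). [folklore] -/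
theorem triple_D (hu : w' * x * y + w * x' * y + w * x * y' = -ρ)
    (hu' : w * x' * y' + w' * x * y' + w' * x' * y = -ρ') (hρ : ρ * ρ' = 1)
    (hw : w ≠ 0) (hx : x ≠ 0) (hy : y ≠ 0) :
    Dsh 1 (x * w') (x' * w) * Dsh 1 (y * w') (y' * w) * Dsh 1 (x * y') (x' * y) =
      1 + ρ' ^ 3 * (w * x * y) + ρ ^ 3 * (w' * x' * y') := by
  have hΓ := D_mul_D hu hu' hx hy
  -- the mate formula for `W` as the mate of `(Y, X)`
  have hv : y' * x * w + y * x' * w + y * x * w' = -ρ := by linear_combination hu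
  have hv' : y * x' * w' + y' * x * w' + y' * x' * w = -ρ' := by linear_combination hu'
  have h4 : w * Dsh 1 (x * y') (x' * y) = ρ' * (y * x) - ρ * (x * y' + x' * y) := mate_mul_D hv hv'
  have h5 : Dsh (-1) (ρ' * w) (ρ * w') * (ρ' * (y * x) - ρ * (x * y' + x' * y)) =
      w * (1 + ρ' ^ 3 * (w * x * y) + ρ ^ 3 * (w' * x' * y')) := by
    unfold Dsh
    linear_combination (-(ρ * ρ' ^ 2 * w) + ρ ^ 2 * ρ' * w') * hu + (-(ρ ^ 3 * w')) * hu' +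
      (w * (ρ * ρ' + 1)) * hρ
  have key : w * (Dsh 1 (x * w') (x' * w) * Dsh 1 (y * w') (y' * w) * Dsh 1 (x * y') (x' * y)) =
      w * (1 + ρ' ^ 3 * (w * x * y) + ρ ^ 3 * (w' * x' * y')) := by
    calc w * (Dsh 1 (x * w') (x' * w) * Dsh 1 (y * w') (y' * w) * Dsh 1 (x * y') (x' * y))
        = (Dsh 1 (x * w') (x' * w) * Dsh 1 (y * w') (y' * w)) * (w * Dsh 1 (x * y') (x' * y)) := by ring
      _ = Dsh (-1) (ρ' * w) (ρ * w') * (ρ' * (y * x) - ρ * (x * y' + x' * y)) := by rw [hΓ, h4]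
      _ = _ := h5
  exact mul_left_cancel₀ hw key

end Algebra

/-! ## The three-set line identity at a non-trivial character -/

section Characters

variable {B : Type*} [AddCommGroup B] [Fintype B] [DecidableEq B]

omit [DecidableEq B] in
/-- `Σ_t X(t − u + v) χ(t) = χ(u − v) χ(X)`. [folklore] -/
theorem sum_shiftA (X : B → ℕ) (χ : AddChar B ℂ) (u v : B) :
    ∑ t, (X (t - u + v) : ℂ) * χ t = χ (u - v) * chs X χ := by
  have := sum_shift₁ X χ (u - v)
  simpa only [sub_sub_eq_add_sub, ← sub_add_eq_add_sub] using this

omit [DecidableEq B] in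
/-- `Σ_t X(v + u − t) χ(t) = χ(v) χ(u) χ⁻¹(X)`. [folklore] -/
theorem sum_shiftB (X : B → ℕ) (χ : AddChar B ℂ) (u v : B) :
    ∑ t, (X (v + u - t) : ℂ) * χ t = χ v * χ u * chs X χ⁻¹ := by
  have := sum_shift₂ X χ v u
  have e : ∀ t : B, v - (t - u) = v + u - t := fun t => by abel
  simpa only [e] using this

omit [DecidableEq B] in
/-- `Σ_t X(t + u − v) χ(t) = χ(v − u) χ(X)`. [folklore] -/
theorem sum_shiftC (X : B → ℕ) (χ : AddChar B ℂ) (u v : B) :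
    ∑ t, (X (t + u - v) : ℂ) * χ t = χ (v - u) * chs X χ := by
  have := sum_shift₁ X χ (v - u)
  have e : ∀ t : B, t - (v - u) = t + u - v := fun t => by abel
  simpa only [e] using this

omit [AddCommGroup B] [DecidableEq B] in
/-- `(Σ_v p(v)) · a · (Σ_u q(u)) = Σ_u Σ_v p(v) · (q(u) · a)`. [folklore] -/
theorem sum_mul_mul_sum (p q : B → ℂ) (a : ℂ) : (∑ v, p v) * a * (∑ u, q u) = ∑ u, ∑ v, p v * (q u * a) := by
  rw [mul_sum]
  refine sum_congr rfl fun u _ => ?_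
  rw [sum_mul, sum_mul]
  exact sum_congr rfl fun v _ => by ring

/-- **Character form of the three-set line identity**: at every `χ ≠ 0`,
`χ⁻¹(W)χ(X)χ(Y) + χ(W)χ⁻¹(X)χ(Y) + χ(W)χ(X)χ⁻¹(Y) = −χ(s)`. [folklore] -/
theorem char_identity₃ (W X Y : B → ℕ) (s : B) (K : ℕ)
    (hID : ∀ t : B, (∑ u, ∑ v, W v * (X (t - u + v) + X (v + u - t) + X (t + u - v)) * Y u) +
      (if s = t then 1 else 0) = K)
    {χ : AddChar B ℂ} (hχ : χ ≠ 0) :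
    chs W χ⁻¹ * chs X χ * chs Y χ + chs W χ * chs X χ⁻¹ * chs Y χ + chs W χ * chs X χ * chs Y χ⁻¹ = -χ s := by
  -- sum `χ t ·` (identity at `t`) over `t`
  have hsum : ∑ t, (((∑ u, ∑ v, W v * (X (t - u + v) + X (v + u - t) + X (t + u - v)) * Y u) +
      (if s = t then 1 else 0) : ℕ) : ℂ) * χ t = ∑ t, (K : ℂ) * χ t :=
    sum_congr rfl fun t _ => by rw [hID t]
  rw [← mul_sum, AddChar.sum_eq_zero_iff_ne_zero.2 hχ, mul_zero] at hsum
  -- expand the left-hand side into three triple sums and the point term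
  have hL : ∀ t, (((∑ u, ∑ v, W v * (X (t - u + v) + X (v + u - t) + X (t + u - v)) * Y u) +
      (if s = t then 1 else 0) : ℕ) : ℂ) * χ t =
      (∑ u, ∑ v, (W v : ℂ) * (Y u : ℂ) * ((X (t - u + v) : ℂ) * χ t)) +
        (∑ u, ∑ v, (W v : ℂ) * (Y u : ℂ) * ((X (v + u - t) : ℂ) * χ t)) +
        (∑ u, ∑ v, (W v : ℂ) * (Y u : ℂ) * ((X (t + u - v) : ℂ) * χ t)) + (if s = t then 1 else 0) * χ t := by
    intro t
    push_cast
    rw [add_mul, sum_mul, ← sum_add_distrib, ← sum_add_distrib]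
    congr 1
    refine sum_congr rfl fun u _ => ?_
    rw [sum_mul, ← sum_add_distrib, ← sum_add_distrib]
    exact sum_congr rfl fun v _ => by ring
  simp_rw [hL, sum_add_distrib] at hsum
  -- move the sum over `t` inside
  rw [sum_comm (f := fun t u => ∑ v, (W v : ℂ) * (Y u : ℂ) * ((X (t - u + v) : ℂ) * χ t)),
    sum_comm (f := fun t u => ∑ v, (W v : ℂ) * (Y u : ℂ) * ((X (v + u - t) : ℂ) * χ t)),
    sum_comm (f := fun t u => ∑ v, (W v : ℂ) * (Y u : ℂ) * ((X (t + u - v) : ℂ) * χ t))] at hsum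
  simp_rw [sum_comm (f := fun t v => (W v : ℂ) * (Y _ : ℂ) * ((X _ : ℂ) * χ t)), ← mul_sum, sum_shiftA, sum_shiftB,
    sum_shiftC, ite_mul, one_mul, zero_mul, Finset.sum_ite_eq, mem_univ, if_true] at hsum
  -- collect into products of character sums
  have e1 : ∑ u, ∑ v, (W v : ℂ) * (Y u : ℂ) * (χ (u - v) * chs X χ) = chs W χ⁻¹ * chs X χ * chs Y χ := by
    rw [show chs W χ⁻¹ * chs X χ * chs Y χ = (∑ v, (W v : ℂ) * χ⁻¹ v) * chs X χ * (∑ u, (Y u : ℂ) * χ u) from rfl,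
      sum_mul_mul_sum]
    refine sum_congr rfl fun u _ => sum_congr rfl fun v _ => ?_
    rw [sub_eq_add_neg, AddChar.map_add_eq_mul, ← AddChar.inv_apply]
    ring
  have e2 : ∑ u, ∑ v, (W v : ℂ) * (Y u : ℂ) * (χ v * χ u * chs X χ⁻¹) = chs W χ * chs X χ⁻¹ * chs Y χ := by
    rw [show chs W χ * chs X χ⁻¹ * chs Y χ = (∑ v, (W v : ℂ) * χ v) * chs X χ⁻¹ * (∑ u, (Y u : ℂ) * χ u) from rfl,
      sum_mul_mul_sum]
    exact sum_congr rfl fun u _ => sum_congr rfl fun v _ => by ring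
  have e3 : ∑ u, ∑ v, (W v : ℂ) * (Y u : ℂ) * (χ (v - u) * chs X χ) = chs W χ * chs X χ * chs Y χ⁻¹ := by
    rw [show chs W χ * chs X χ * chs Y χ⁻¹ = (∑ v, (W v : ℂ) * χ v) * chs X χ * (∑ u, (Y u : ℂ) * χ⁻¹ u) from rfl,
      sum_mul_mul_sum]
    refine sum_congr rfl fun u _ => sum_congr rfl fun v _ => ?_
    rw [sub_eq_add_neg, AddChar.map_add_eq_mul, ← AddChar.inv_apply]
    ring
  rw [e1, e2, e3] at hsum
  linear_combination hsum

omit [Fintype B] [DecidableEq B] in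
/-- Unitarity: `χ(b) χ⁻¹(b) = 1`. [folklore] -/
theorem addChar_mul_inv_apply (χ : AddChar B ℂ) (b : B) : χ b * χ⁻¹ b = 1 := by
  rw [AddChar.inv_apply, ← AddChar.map_add_eq_mul, add_neg_cancel, AddChar.map_zero_eq_one]

/-- Under the three-set line identity no character sum of `W`, `X`, `Y` vanishes at `χ ≠ 0`. [folklore] -/
theorem chs_ne_zero (W X Y : B → ℕ) (s : B) (K : ℕ)
    (hID : ∀ t : B, (∑ u, ∑ v, W v * (X (t - u + v) + X (v + u - t) + X (t + u - v)) * Y u) +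
      (if s = t then 1 else 0) = K)
    {χ : AddChar B ℂ} (hχ : χ ≠ 0) : chs W χ ≠ 0 ∧ chs X χ ≠ 0 ∧ chs Y χ ≠ 0 := by
  have h := char_identity₃ W X Y s K hID hχ
  have hs : χ s ≠ 0 := fun h0 => by simpa [h0] using addChar_mul_inv_apply χ s
  have conj0 : ∀ F : B → ℕ, chs F χ = 0 → chs F χ⁻¹ = 0 := fun F h0 => by
    rw [← conj_chs, h0, map_zero]
  refine ⟨fun h0 => hs ?_, fun h0 => hs ?_, fun h0 => hs ?_⟩
  · have h0' := conj0 W h0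
    rw [h0, h0'] at h; linear_combination h
  · have h0' := conj0 X h0
    rw [h0, h0'] at h; linear_combination h
  · have h0' := conj0 Y h0
    rw [h0, h0'] at h; linear_combination h

/-- **Mate formula for character sums**: `χ(Y) · D(χ(X)χ⁻¹(W), χ⁻¹(X)χ(W)) = χ⁻¹(s)χ(W)χ(X) − χ(s)(χ(X)χ⁻¹(W) + χ⁻¹(X)χ(W))`
at every `χ ≠ 0`: the count function of the third set is determined by the other two and `s`. [folklore] -/
theorem chs_mate (W X Y : B → ℕ) (s : B) (K : ℕ)
    (hID : ∀ t : B, (∑ u, ∑ v, W v * (X (t - u + v) + X (v + u - t) + X (t + u - v)) * Y u) +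
      (if s = t then 1 else 0) = K)
    {χ : AddChar B ℂ} (hχ : χ ≠ 0) :
    chs Y χ * Dsh 1 (chs X χ * chs W χ⁻¹) (chs X χ⁻¹ * chs W χ) =
      χ⁻¹ s * (chs W χ * chs X χ) - χ s * (chs X χ * chs W χ⁻¹ + chs X χ⁻¹ * chs W χ) := by
  have h1 := char_identity₃ W X Y s K hID hχ
  have h2 := char_identity₃ W X Y s K hID (inv_ne_one.2 hχ)
  rw [inv_inv] at h2
  exact mate_mul_D h1 h2

/-- **Pair products for character sums**: `D_WX(χ) · D_WY(χ) = Γ_W(χ) = χ⁻¹(s)²w² − ww̄ + χ(s)²w̄²` at every `χ ≠ 0`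
(`w = χ(W)`, `w̄ = χ⁻¹(W)`). [folklore] -/
theorem chs_D_mul_D (W X Y : B → ℕ) (s : B) (K : ℕ)
    (hID : ∀ t : B, (∑ u, ∑ v, W v * (X (t - u + v) + X (v + u - t) + X (t + u - v)) * Y u) +
      (if s = t then 1 else 0) = K)
    {χ : AddChar B ℂ} (hχ : χ ≠ 0) :
    Dsh 1 (chs X χ * chs W χ⁻¹) (chs X χ⁻¹ * chs W χ) * Dsh 1 (chs Y χ * chs W χ⁻¹) (chs Y χ⁻¹ * chs W χ) =
      Dsh (-1) (χ⁻¹ s * chs W χ) (χ s * chs W χ⁻¹) := by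
  have h1 := char_identity₃ W X Y s K hID hχ
  have h2 := char_identity₃ W X Y s K hID (inv_ne_one.2 hχ)
  rw [inv_inv] at h2
  obtain ⟨-, hx, hy⟩ := chs_ne_zero W X Y s K hID hχ
  exact D_mul_D h1 h2 hx hy

/-- **Triple product for character sums**: `D_WX(χ) · D_WY(χ) · D_XY(χ) = 1 + χ⁻¹(s)³·wxy + χ(s)³·w̄x̄ȳ` at `χ ≠ 0`.
[folklore] -/
theorem chs_triple_D (W X Y : B → ℕ) (s : B) (K : ℕ)
    (hID : ∀ t : B, (∑ u, ∑ v, W v * (X (t - u + v) + X (v + u - t) + X (t + u - v)) * Y u) +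
      (if s = t then 1 else 0) = K)
    {χ : AddChar B ℂ} (hχ : χ ≠ 0) :
    Dsh 1 (chs X χ * chs W χ⁻¹) (chs X χ⁻¹ * chs W χ) * Dsh 1 (chs Y χ * chs W χ⁻¹) (chs Y χ⁻¹ * chs W χ) *
        Dsh 1 (chs X χ * chs Y χ⁻¹) (chs X χ⁻¹ * chs Y χ) =
      1 + χ⁻¹ s ^ 3 * (chs W χ * chs X χ * chs Y χ) + χ s ^ 3 * (chs W χ⁻¹ * chs X χ⁻¹ * chs Y χ⁻¹) := by
  have h1 := char_identity₃ W X Y s K hID hχ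
  have h2 := char_identity₃ W X Y s K hID (inv_ne_one.2 hχ)
  rw [inv_inv] at h2
  obtain ⟨hw, hx, hy⟩ := chs_ne_zero W X Y s K hID hχ
  exact triple_D h1 h2 (addChar_mul_inv_apply χ s) hw hx hy

/-- **Twisted products for character sums**: `(w + t w̄)(x + t x̄)(y + t ȳ) = wxy − tχ(s) − t²χ⁻¹(s) + t³ w̄x̄ȳ`. [folklore] -/
theorem chs_prod_twist (W X Y : B → ℕ) (s : B) (K : ℕ)
    (hID : ∀ t : B, (∑ u, ∑ v, W v * (X (t - u + v) + X (v + u - t) + X (t + u - v)) * Y u) +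
      (if s = t then 1 else 0) = K)
    {χ : AddChar B ℂ} (hχ : χ ≠ 0) (t : ℂ) :
    (chs W χ + t * chs W χ⁻¹) * (chs X χ + t * chs X χ⁻¹) * (chs Y χ + t * chs Y χ⁻¹) =
      chs W χ * chs X χ * chs Y χ - t * χ s - t ^ 2 * χ⁻¹ s + t ^ 3 * (chs W χ⁻¹ * chs X χ⁻¹ * chs Y χ⁻¹) := by
  have h1 := char_identity₃ W X Y s K hID hχ
  have h2 := char_identity₃ W X Y s K hID (inv_ne_one.2 hχ)
  rw [inv_inv] at h2
  exact prod_twist h1 h2 t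

end Characters

/-! ## From a three-set cube form over `A ↠ B` -/

section CubeForm

variable {A B : Type*} [AddCommGroup A] [Fintype A] [DecidableEq A] [AddCommGroup B] [Fintype B] [DecidableEq B]

/-- The three-set line identity of `radon_identity₃` for the fibre counts of a three-set cube form `(W, X, Y, x₀)`
(`CubeSymmetricForm.cube_symmetric_form_of_law`) over a surjection `φ : A ↠ B`, with constant right-hand side
`|φ⁻¹(0)|`. [folklore] -/
theorem three_set_line_identity (φ : A →+ B) (hφ : Function.Surjective φ) {W X Y : Finset A} {x₀ : A}
    (h₁ : Set.InjOn (fun p : A × A × A => -p.1 + p.2.1 + p.2.2) ↑(W ×ˢ X ×ˢ Y))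
    (h₂ : Set.InjOn (fun p : A × A × A => p.1 - p.2.1 + p.2.2) ↑(W ×ˢ X ×ˢ Y))
    (h₃ : Set.InjOn (fun p : A × A × A => p.1 + p.2.1 - p.2.2) ↑(W ×ˢ X ×ˢ Y))
    (d₁₂ : Disjoint ((W ×ˢ X ×ˢ Y).image fun p : A × A × A => -p.1 + p.2.1 + p.2.2)
      ((W ×ˢ X ×ˢ Y).image fun p : A × A × A => p.1 - p.2.1 + p.2.2))
    (d₁₃ : Disjoint ((W ×ˢ X ×ˢ Y).image fun p : A × A × A => -p.1 + p.2.1 + p.2.2)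
      ((W ×ˢ X ×ˢ Y).image fun p : A × A × A => p.1 + p.2.1 - p.2.2))
    (d₂₃ : Disjoint ((W ×ˢ X ×ˢ Y).image fun p : A × A × A => p.1 - p.2.1 + p.2.2)
      ((W ×ˢ X ×ˢ Y).image fun p : A × A × A => p.1 + p.2.1 - p.2.2))
    (hcover : ((W ×ˢ X ×ˢ Y).image fun p : A × A × A => -p.1 + p.2.1 + p.2.2) ∪
      ((W ×ˢ X ×ˢ Y).image fun p : A × A × A => p.1 - p.2.1 + p.2.2) ∪
      ((W ×ˢ X ×ˢ Y).image fun p : A × A × A => p.1 + p.2.1 - p.2.2) = univ.erase x₀) (t : B) :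
    (∑ u : B, ∑ v : B, (W.filter fun a => φ a = v).card *
        ((X.filter fun a => φ a = t - u + v).card + (X.filter fun a => φ a = v + u - t).card +
          (X.filter fun a => φ a = t + u - v).card) * (Y.filter fun a => φ a = u).card) +
      (if φ x₀ = t then 1 else 0) = (univ.filter fun a : A => φ a = 0).card := by
  rw [← card_fibre_eq_of_surjective φ hφ t 0]
  exact radon_identity₃ φ h₁ h₂ h₃ d₁₂ d₁₃ d₂₃ hcover t

/-- **Norm relations of a three-set cube form over `A ↠ B`.**  For the fibre counts `W_φ, X_φ, Y_φ : B → ℕ` of a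
three-set cube form and every character `χ ≠ 0` of `B` (`s = φ x₀`, `w = χ(W_φ)`, `w̄ = χ⁻¹(W_φ)`, …): no character sum
vanishes, `D_WX · D_WY = χ⁻¹(s)²w² − ww̄ + χ(s)²w̄²`, and `D_WX · D_WY · D_XY = 1 + χ⁻¹(s)³ wxy + χ(s)³ w̄x̄ȳ`. [folklore] -/
theorem cube_form_chs_norm_relations (φ : A →+ B) (hφ : Function.Surjective φ) {W X Y : Finset A} {x₀ : A}
    (h₁ : Set.InjOn (fun p : A × A × A => -p.1 + p.2.1 + p.2.2) ↑(W ×ˢ X ×ˢ Y))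
    (h₂ : Set.InjOn (fun p : A × A × A => p.1 - p.2.1 + p.2.2) ↑(W ×ˢ X ×ˢ Y))
    (h₃ : Set.InjOn (fun p : A × A × A => p.1 + p.2.1 - p.2.2) ↑(W ×ˢ X ×ˢ Y))
    (d₁₂ : Disjoint ((W ×ˢ X ×ˢ Y).image fun p : A × A × A => -p.1 + p.2.1 + p.2.2)
      ((W ×ˢ X ×ˢ Y).image fun p : A × A × A => p.1 - p.2.1 + p.2.2))
    (d₁₃ : Disjoint ((W ×ˢ X ×ˢ Y).image fun p : A × A × A => -p.1 + p.2.1 + p.2.2)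
      ((W ×ˢ X ×ˢ Y).image fun p : A × A × A => p.1 + p.2.1 - p.2.2))
    (d₂₃ : Disjoint ((W ×ˢ X ×ˢ Y).image fun p : A × A × A => p.1 - p.2.1 + p.2.2)
      ((W ×ˢ X ×ˢ Y).image fun p : A × A × A => p.1 + p.2.1 - p.2.2))
    (hcover : ((W ×ˢ X ×ˢ Y).image fun p : A × A × A => -p.1 + p.2.1 + p.2.2) ∪
      ((W ×ˢ X ×ˢ Y).image fun p : A × A × A => p.1 - p.2.1 + p.2.2) ∪
      ((W ×ˢ X ×ˢ Y).image fun p : A × A × A => p.1 + p.2.1 - p.2.2) = univ.erase x₀)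
    {χ : AddChar B ℂ} (hχ : χ ≠ 0) :
    let Wc : B → ℕ := fun v => (W.filter fun a => φ a = v).card
    let Xc : B → ℕ := fun v => (X.filter fun a => φ a = v).card
    let Yc : B → ℕ := fun v => (Y.filter fun a => φ a = v).card
    (chs Wc χ ≠ 0 ∧ chs Xc χ ≠ 0 ∧ chs Yc χ ≠ 0) ∧
    Dsh 1 (chs Xc χ * chs Wc χ⁻¹) (chs Xc χ⁻¹ * chs Wc χ) * Dsh 1 (chs Yc χ * chs Wc χ⁻¹) (chs Yc χ⁻¹ * chs Wc χ) =
      Dsh (-1) (χ⁻¹ (φ x₀) * chs Wc χ) (χ (φ x₀) * chs Wc χ⁻¹) ∧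
    Dsh 1 (chs Xc χ * chs Wc χ⁻¹) (chs Xc χ⁻¹ * chs Wc χ) * Dsh 1 (chs Yc χ * chs Wc χ⁻¹) (chs Yc χ⁻¹ * chs Wc χ) *
        Dsh 1 (chs Xc χ * chs Yc χ⁻¹) (chs Xc χ⁻¹ * chs Yc χ) =
      1 + χ⁻¹ (φ x₀) ^ 3 * (chs Wc χ * chs Xc χ * chs Yc χ) +
        χ (φ x₀) ^ 3 * (chs Wc χ⁻¹ * chs Xc χ⁻¹ * chs Yc χ⁻¹) := by
  intro Wc Xc Yc
  have hID : ∀ t : B, (∑ u, ∑ v, Wc v * (Xc (t - u + v) + Xc (v + u - t) + Xc (t + u - v)) * Yc u) +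
      (if φ x₀ = t then 1 else 0) = (univ.filter fun a : A => φ a = 0).card :=
    three_set_line_identity φ hφ h₁ h₂ h₃ d₁₂ d₁₃ d₂₃ hcover
  exact ⟨chs_ne_zero Wc Xc Yc (φ x₀) _ hID hχ, chs_D_mul_D Wc Xc Yc (φ x₀) _ hID hχ,
    chs_triple_D Wc Xc Yc (φ x₀) _ hID hχ⟩

end CubeForm

end Summit.MatrixMultiplication.OmegaCensus.ThreeSetNorm
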